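import Summits.ValiantsHypothesis.ValiantsHypothesis.Theorems.DefinabilityGapAlteration
import Summits.ValiantsHypothesis.ValiantsHypothesis.Theorems.DefinabilityGapPivotLiveBad
import Summits.ValiantsHypothesis.ValiantsHypothesis.Theorems.DefinabilityGapFewBadReadout
import Summits.ValiantsHypothesis.ValiantsHypothesis.Theorems.DefinabilityGapSymmetry
import HarnessLib

/-!
# Definability gap: GIRTH `> 2q+1` OF THE PLANTED KI-PERMANENT DESIGN, and K1's clause one

The end of ROAD P (lens-5, NODE v7).  `DefinabilityGapAlteration` supplies, for all large `m`
and every family `T` of at most `2q+1` curves, a pivot column and rows off the Phase-A bad set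
of schedule A with the pivot column free for every curve; the read-off
(`phaseA_of_not_mem`, `fewBad_clauses`, `pivots_injective_iff`, `kiPivotCertificate_of_fewBad`)
turns this into a one-column PIVOT CERTIFICATE, whence (`DefinabilityGapPivotCertificate`)
the block permanents `{kiPer m c : c ∈ T}` are ALGEBRAICALLY INDEPENDENT:
**`girth_eventually`** — the algebraic matroid of the `q³` block permanents of the planted
KI design has girth `> 2q+1` for all large `m`.  By the support/symmetry hitting lemma
(`kiPer_hits_size_of_indep`: a nonzero `D` of circuit complexity `s` involves `≤ 2s+1` variables)
this gives **`kiPlantedHitting_one`** — the exponent-one clause of the route crux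
`KIPlantedHitting` (R_K1.1): for infinitely many `m`, every nonzero `D` with `complexity D ≤ q`
(and `deg D ≤ q`, unused) has `D ∘ G_m ≠ 0` — indeed for ALL large `m` and with no degree
hypothesis (`kiPer_hits_linear`).
-/

namespace Summit.ValiantsHypothesis.ValiantsHypothesis.Theorems.DefinabilityGapGirth

open MvPolynomial
open Literature.Computability.AlgebraicComplexity Literature.Computability.MetaComplexity
open Summit.ValiantsHypothesis.ValiantsHypothesis.Theorems.DefinabilityGapAffineRung
open Summit.ValiantsHypothesis.ValiantsHypothesis.Theorems.DefinabilityGapSymmetry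
open Summit.ValiantsHypothesis.ValiantsHypothesis.Theorems.DefinabilityGapPivotCertificate
open Summit.ValiantsHypothesis.ValiantsHypothesis.Theorems.DefinabilityGapPivotLiveBad
open Summit.ValiantsHypothesis.ValiantsHypothesis.Theorems.DefinabilityGapPivotAdmissible
open Summit.ValiantsHypothesis.ValiantsHypothesis.Theorems.DefinabilityGapPivotCrowded
open Summit.ValiantsHypothesis.ValiantsHypothesis.Theorems.DefinabilityGapCrowdedFree
open Summit.ValiantsHypothesis.ValiantsHypothesis.Theorems.DefinabilityGapFewBadReadout
open Summit.ValiantsHypothesis.ValiantsHypothesis.Theorems.DefinabilityGapPhaseAExists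
open Summit.ValiantsHypothesis.ValiantsHypothesis.Theorems.DefinabilityGapPhaseABad
open Summit.ValiantsHypothesis.ValiantsHypothesis.Theorems.DefinabilityGapAsymptotics
open Summit.ValiantsHypothesis.ValiantsHypothesis.Theorems.DefinabilityGapNumerics
open Summit.ValiantsHypothesis.ValiantsHypothesis.Theorems.DefinabilityGapRoundOne
open Summit.ValiantsHypothesis.ValiantsHypothesis.Theorems.DefinabilityGapAlteration

/-! ## 1. Pivot certificates for all large `m` -/

/-- **ROAD P, eventually**: for all large `m`, every `T` with `#T ≤ 2q+1` has a one-column pivot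
certificate. [this file] -/
theorem pivotCertifiable_eventually : ∃ m₀ : ℕ, ∀ m : ℕ, m₀ ≤ m →
    ∀ T : Finset (Fin 3 → Fin (qOf m)), T.card ≤ 2 * qOf m + 1 → KIPivotCertifiable m T := by
  classical
  obtain ⟨m₁, h₁⟩ := kiPivotAltered_A
  obtain ⟨m₂, h₂⟩ := scheduleA_ok
  refine ⟨max m₁ m₂, fun m hm T hT => ?_⟩
  obtain ⟨s₀, r, hr, hrule, hfree⟩ := h₁ m (le_of_max_le_left hm) T hT
  obtain ⟨hbudget, hn₀, hMLB⟩ := h₂ m (le_of_max_le_right hm)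
  obtain ⟨hbad, hF, hG⟩ := phaseA_of_not_mem T hbudget hr
  have hrule' : ∀ c' ∈ T, r c' ∉ heavyRows T c' (NC m) := fun c' _ => hrule c'
  have hlt_of : ∀ {k : ℕ} {c : Fin 3 → Fin (qOf m)}, c ∈ T →
      MC m * LC m * k ≤ 2 * (T.erase c).card → k + 1 ≤ BA m := by
    intro k c hc hk
    have h1 : (T.erase c).card + 1 = T.card := Finset.card_erase_add_one hc
    have h2 : MC m * LC m * k < MC m * LC m * BA m := by omega
    exact Nat.lt_of_mul_lt_mul_left h2
  obtain ⟨h2, h3⟩ := fewBad_clauses T s₀ r hrule' hn₀ (fun c hc => hlt_of hc (hbad s₀ c hc).1)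
    (fun c hc => hlt_of hc (hbad s₀ c hc).2) (fun c hc i hi => by exact_mod_cast hF c hc i hi)
    (fun c hc j hj => by exact_mod_cast hG c hc j hj)
  exact ⟨s₀, r, kiPivotCertificate_of_fewBad T s₀ r ((pivots_injective_iff T s₀ r).mpr hfree)
    h2 h3⟩

/-! ## 2. Girth -/

/-- **GIRTH `> 2q+1`**: for all large `m`, any `≤ 2q+1` block permanents of the planted KI design
are algebraically independent over `ℂ`. [this file] -/
theorem girth_eventually : ∃ m₀ : ℕ, ∀ m : ℕ, m₀ ≤ m →
    ∀ T : Finset (Fin 3 → Fin (qOf m)), T.card ≤ 2 * qOf m + 1 →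
      AlgebraicIndependent ℂ (fun c : T => kiPer m (c : Fin 3 → Fin (qOf m))) := by
  obtain ⟨m₀, h⟩ := pivotCertifiable_eventually
  exact ⟨m₀, fun m hm T hT => kiPer_algebraicIndependent_of_pivotCertifiable m T (h m hm T hT)⟩

/-! ## 3. K1, clause one -/

/-- **LINEAR-SIZE HITTING**: for all large `m`, every nonzero `D` of circuit complexity `≤ q`
composes to a nonzero polynomial under the planted generator. [this file] -/
theorem kiPer_hits_linear : ∃ m₀ : ℕ, ∀ m : ℕ, m₀ ≤ m →
    ∀ D : MvPolynomial (Fin 3 → Fin (qOf m)) ℂ, D ≠ 0 → complexity D ≤ qOf m →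
      bind₁ (kiPer m) D ≠ 0 := by
  obtain ⟨m₀, h⟩ := girth_eventually
  refine ⟨m₀, fun m hm D hD hL => ?_⟩
  exact kiPer_hits_size_of_indep m (2 * qOf m + 1) (h m hm) hD (by omega)

/-- **K1, CLAUSE ONE (R_K1.1)** — the exponent-`1` clause of the route crux `KIPlantedHitting`:
for infinitely many `m`, every nonzero `D` with `complexity D ≤ q` and `deg D ≤ q` satisfies
`D ∘ G_m ≠ 0`. [this file] -/
theorem kiPlantedHitting_one : ∀ m₀ : ℕ, ∃ m, m₀ ≤ m ∧
    ∀ D : MvPolynomial (Fin 3 → Fin (qOf m)) ℂ, D ≠ 0 →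
      complexity D ≤ qOf m ^ 1 → D.totalDegree ≤ qOf m ^ 1 → bind₁ (kiPer m) D ≠ 0 := by
  obtain ⟨m₁, hm₁⟩ := kiPer_hits_linear
  intro m₀
  refine ⟨max m₀ m₁, le_max_left _ _, fun D hD hL _ => ?_⟩
  rw [pow_one] at hL
  exact hm₁ _ (le_max_right _ _) D hD hL

end Summit.ValiantsHypothesis.ValiantsHypothesis.Theorems.DefinabilityGapGirth
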